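import Literature.Geometry.Riemannian.SharpLogSobolevAVRProofs
import Literature.Geometry.Riemannian.GaussBonnetGradient
import Literature.Geometry.Lorentzian.DalembertianCompose
import Literature.Geometry.Riemannian.ABPVolumeEstimate
import Literature.Geometry.Riemannian.CartanHadamardLift
import Literature.Geometry.Riemannian.RegularSublevelDomain
import HarnessLib

/-!
# `sharpLogSobolevAVR_four` from the solvability of Brendle's Neumann problem
# (Brendle, CPAM 76 (2023), Thm. 1.1: the PDE half isolated as a hypothesis)

Topic `Geometry/Riemannian`. The fact `Literature.Geometry.Riemannian.sharpLogSobolevAVR_four`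
(Balogh–Kristály–Tripaldi, Thm. 1.1 for `p = 2`, `N = 4`) was reduced by
`sharpLogSobolevAVR_four_of_l1Sobolev` to Brendle's sharp `L¹`-Sobolev inequality
`4 |B⁴|^{1/4} θ^{1/4} ‖φ‖_{4/3} ≤ ∫ |∇φ|` for `φ ∈ C_c^∞`, i.e. to Brendle's Thm. 1.1, whose proof
(CPAM 76 (2023), §2) consists of a PDE step and a geometric (ABP) step; the geometric step is the
tree's `abp_volume_estimate_of_contact` (`ABPVolumeEstimate.lean`). This file performs the
remaining elementary parts of Brendle's §2 (Lemma 2.1, the normalisation, the regularisation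
`f = √(φ² + δ²)` and the limits) and thereby reduces the fact to the PDE step ALONE, stated as the
hypothesis schema `HPDE` of `sharpLogSobolevAVR_four_of_neumannABP`:

> **Neumann–ABP solvability** (Brendle 2023, §2, second paragraph and first sentence of the proof
> of Lemma 2.2). On the data of the fact, for every compact `K ⊆ P` there are an open `D ⊇ K` with
> compact closure and a constant `σ ≥ 0` (for a smooth domain: `σ = |∂D|`) such that for all
> smooth `f > 0` with `f ≡ c` off `K` and all smooth `F` with `c σ ≤ ∫_D F` there is a smooth `u`
> on `P` with `f Δu + ⟨∇f, ∇u⟩ = F` on `D` (i.e. `div(f∇u) = F`) such that for every `r > 0` and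
> every `p` with `d(x,p) < r` on `D̄` the function `x ↦ r u(x) + ½ d(x,p)²` attains its minimum
> over `D̄` inside `D`.

For a smooth bounded domain `D` of the (noncompact, since `θ > 0`) manifold this is the
solvability of the linear uniformly elliptic Neumann problem `div(f∇u) = F` in `D`,
`∂_η u = β := (∫_D F)/(cσ) ≥ 1` on `∂D`, with `u ∈ C^∞(D̄)` (Gilbarg–Trudinger, Thm. 6.31 and
Schauder estimates) extended smoothly to `P`, together with Brendle's remark that `∂_η u ≥ 1`
excludes boundary minima of `r u + ½ d(·,p)²` when `d(·,p) < r` on `D̄` — elliptic boundary-value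
theory which neither Mathlib nor the tree has. Everything else in Brendle's proof is now formal:

* `sharpLogSobolevAVR_four_of_neumannABP` — given `HPDE`, for `φ ∈ C_c^∞(P)`, `δ, τ > 0`: put
  `K = supp φ`, `f = √(φ² + δ²)` (`= δ` off `K`, `|φ| ≤ f`, `|∇f| ≤ |∇φ|`), `s = √(|∇f|² + τ²)`,
  `I = ∫_D f^{4/3}`, `S = ∫_D s`, `λ = (S + δσ)/(4I)`, `F = 4λ f^{4/3} − s` (so `∫_D F = δσ`); the
  solution `u` satisfies `Δu ≤ 4λ f^{1/3}` on `D ∩ {|∇u| < 1}` (Brendle's Lemma 2.1: Cauchy–Schwarz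
  `−⟨∇f,∇u⟩ ≤ |∇f| ≤ s`), hence by `abp_volume_estimate_of_contact` with `κ = λ f^{1/3}`,
  `θ |B⁴| ≤ ∫_U κ⁴ ≤ λ⁴ I`, i.e. `4 |B⁴|^{1/4} θ^{1/4} I^{3/4} ≤ S + δσ ≤ ∫|∇φ| + τ Vol(D) + δσ`,
  and `I ≥ ∫ |φ|^{4/3}`; let `δ, τ → 0`. This is hypothesis `H` of
  `sharpLogSobolevAVR_four_of_l1Sobolev`, which concludes.

* `sharpLogSobolevAVR_four_of_neumannABP_le` — the same with the PDE only as the supersolution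
  inequality `f Δu + ⟨∇f, ∇u⟩ ≤ F` (Lemma 2.1 needs no more); the `=` form is its corollary.
* `exists_interior_min_of_neumann` — Brendle's remark (proof of Lemma 2.2, first sentence): for a
  smooth relatively compact domain `D = {σ < 0}` (`∇σ ≠ 0` on `{σ = 0}`) and `u` with
  `g(∇u, ∇σ) ≥ |∇σ|` on `∂D` (`∂_η u ≥ 1`), the minimum of `r u + ½ d(·,p)²` over `D̄` is attained
  in `D` whenever `d(·, p) < r` on `D̄` (inward geodesic `exp_z(-t∇σ)`, triangle inequality).
* `sharpLogSobolevAVR_four_of_neumann` — the glue with the hypothesis in Brendle's own Neumann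
  form: `∀ K` compact `∃` a smooth relatively compact domain `{σ < 0} ⊇ K` and `A ≥ 0` such that
  the Neumann problem `f Δu + ⟨∇f, ∇u⟩ ≤ F` in `{σ < 0}`, `g(∇u, ∇σ) ≥ |∇σ|` on `{σ = 0}` has a
  smooth (super)solution whenever `c A ≤ ∫_{σ<0} F`. THIS is now the exact residual of the fact:
  linear elliptic Neumann theory with regularity up to the boundary (Gilbarg–Trudinger Thm. 6.31
  and Schauder estimates), absent from Mathlib and the tree.
* `sharpLogSobolevAVR_four_of_neumannSolvability` — the final form: since every compact `K`
  lies in a smooth relatively compact regular domain (`exists_regular_sublevel_domain_gradSq`,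
  smooth exhaustion + Sard), it suffices that Brendle's Neumann problem be (super)solvable with a
  smooth solution on EVERY given smooth relatively compact regular domain `{σ < 0}` of `P`.

Helpers: `gradSq_eq_val_grad`, `gradSq_comp_eq_deriv_sq_mul` (chain rule for `|∇(η∘u)|²`),
`gradSq_sqrt_sq_add_sq_le_gradSq`, `contMDiff_sqrt_of_pos`, `contMDiff_sqrt_sq_add_sq`,
`contMDiff_rpow_const_of_pos`, `hasDerivAt_comp_curve_of_mdifferentiableAt`,
`mvfderiv_congr_point'`, `exists_inward_curve`, `mem_closure_setOf_lt_of_gradSq_pos`,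
`closure_setOf_lt_eq_of_gradSq_pos`. Pure proofs; no definitions, no named facts.

## References

* [Brendle2022] S. Brendle, CPAM 76 (2023) 2192–2218 (arXiv:2009.13717), Thm. 1.1 and §2
  (normalisation, the Neumann problem, Lemma 2.1, the concluding displays). READ (arXiv v2,
  pp. 4–6).
* [BaloghKristalyTripaldi2024] Z. Balogh, A. Kristály, F. Tripaldi, arXiv:2210.15774, Thm. 1.1,
  §3.1.
* D. Gilbarg, N. Trudinger, *Elliptic PDE of second order*, Thm. 6.31 (the cited regularity).
-/

noncomputable section

open Bundle Set Function Filter MeasureTheory Manifold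
open scoped Manifold ContDiff Topology

namespace Literature.Geometry.Riemannian

open Lorentzian Lorentzian.PseudoRiemannianMetric

section GlueHelpers

variable {m : ℕ} {M : Type*} [TopologicalSpace M] [ChartedSpace (EuclideanSpace ℝ (Fin m)) M]
  [IsManifold (𝓡 m) ∞ M]
  (g : PseudoRiemannianMetric (𝓡 m) ∞ (EuclideanSpace ℝ (Fin m)) (TangentSpace (𝓡 m) : M → Type _))

/-- `|∇f|²_g = g(∇f, ∇f)` (`val_grad`). [folklore] -/
theorem gradSq_eq_val_grad (f : M → ℝ) (x : M) :
    g.gradSq f x = g.val x (grad g f x) (grad g f x) := by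
  rw [val_grad]; rfl

/-- **Chain rule for the gradient square**: `|∇(η ∘ u)|² = η'(u)² |∇u|²` (`mvfderiv_real_comp`).
[folklore] -/
theorem gradSq_comp_eq_deriv_sq_mul {u : M → ℝ} {η : ℝ → ℝ} {x : M}
    (hη : DifferentiableAt ℝ η (u x)) (hu : MDifferentiableAt (𝓡 m) 𝓘(ℝ, ℝ) u x) :
    g.gradSq (η ∘ u) x = deriv η (u x) ^ 2 * g.gradSq u x := by
  have hd : mvfderiv (𝓡 m) (η ∘ u) x = deriv η (u x) • mvfderiv (𝓡 m) u x := by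
    ext v
    rw [mvfderiv_real_comp hη hu v, _root_.smul_apply, smul_eq_mul]
  simp only [gradSq_eq, hd, ContinuousLinearMap.toLinearMap_smul, map_smul, _root_.smul_apply,
    smul_eq_mul]
  ring

/-- **`|∇√(φ² + δ²)|² ≤ |∇φ|²`** for a Riemannian metric and `δ > 0` (chain rule with
`η(t) = √(t² + δ²)`, `η'² ≤ 1`; the regularisation used in Brendle's `C_c^∞` corollary).
[cite: Brendle2022, Thm. 1.1 (proof)] -/
theorem gradSq_sqrt_sq_add_sq_le_gradSq (hg : g.IsRiemannian) {φ : M → ℝ} {x : M}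
    (hφ : MDifferentiableAt (𝓡 m) 𝓘(ℝ, ℝ) φ x) {δ : ℝ} (hδ : 0 < δ) :
    g.gradSq (fun y ↦ Real.sqrt (φ y ^ 2 + δ ^ 2)) x ≤ g.gradSq φ x := by
  set η : ℝ → ℝ := fun t ↦ Real.sqrt (t ^ 2 + δ ^ 2) with hη
  have hpos : ∀ t, 0 < t ^ 2 + δ ^ 2 := fun t ↦ by positivity
  have hηd : ∀ t, HasDerivAt η (t / Real.sqrt (t ^ 2 + δ ^ 2)) t := by
    intro t
    have h1 : HasDerivAt (fun t ↦ t ^ 2 + δ ^ 2) (2 * t) t := by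
      simpa using (hasDerivAt_pow 2 t).add_const (δ ^ 2)
    have h2 := h1.sqrt (hpos t).ne'
    convert h2 using 1
    field_simp
  have h := gradSq_comp_eq_deriv_sq_mul g (η := η) (u := φ) (x := x) (hηd (φ x)).differentiableAt hφ
  rw [show (fun y ↦ Real.sqrt (φ y ^ 2 + δ ^ 2)) = η ∘ φ from rfl, h, (hηd (φ x)).deriv]
  have hg0 : 0 ≤ g.gradSq φ x := by
    rw [gradSq_eq_val_grad]
    by_cases hz : grad g φ x = 0
    · rw [hz]; simp
    · exact (hg x _ hz).le
  have hle : (φ x / Real.sqrt (φ x ^ 2 + δ ^ 2)) ^ 2 ≤ 1 := by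
    rw [div_pow, Real.sq_sqrt (hpos _).le, div_le_one (hpos _)]
    nlinarith
  nlinarith

omit [IsManifold (𝓡 m) ∞ M] in
/-- `√w` is smooth for a positive smooth `w`. [folklore] -/
theorem contMDiff_sqrt_of_pos {w : M → ℝ} (hw : ContMDiff (𝓡 m) 𝓘(ℝ, ℝ) ∞ w)
    (hpos : ∀ x, 0 < w x) : ContMDiff (𝓡 m) 𝓘(ℝ, ℝ) ∞ fun x ↦ Real.sqrt (w x) := by
  intro x
  have h2 : ContDiffAt ℝ ∞ Real.sqrt (w x) := Real.contDiffAt_sqrt (hpos x).ne'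
  exact h2.contMDiffAt.comp x (hw x)

omit [IsManifold (𝓡 m) ∞ M] in
/-- `√(φ² + δ²)` is smooth for smooth `φ` and `δ > 0`. [folklore] -/
theorem contMDiff_sqrt_sq_add_sq {φ : M → ℝ} (hφ : ContMDiff (𝓡 m) 𝓘(ℝ, ℝ) ∞ φ) {δ : ℝ}
    (hδ : 0 < δ) : ContMDiff (𝓡 m) 𝓘(ℝ, ℝ) ∞ fun x ↦ Real.sqrt (φ x ^ 2 + δ ^ 2) :=
  contMDiff_sqrt_of_pos (((contDiff_id.pow 2).add contDiff_const).comp_contMDiff hφ)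
    fun x ↦ by positivity

omit [IsManifold (𝓡 m) ∞ M] in
/-- `f ^ p` (real power) is smooth for a positive smooth `f`. [folklore] -/
theorem contMDiff_rpow_const_of_pos {f : M → ℝ} (hf : ContMDiff (𝓡 m) 𝓘(ℝ, ℝ) ∞ f)
    (hpos : ∀ x, 0 < f x) (p : ℝ) : ContMDiff (𝓡 m) 𝓘(ℝ, ℝ) ∞ fun x ↦ f x ^ p := by
  intro x
  have h2 : ContDiffAt ℝ ∞ (fun t : ℝ ↦ t ^ p) (f x) :=
    Real.contDiffAt_rpow_const_of_ne (hpos x).ne'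
  exact h2.contMDiffAt.comp x (hf x)

end GlueHelpers


/-! ### From the Neumann–ABP solvability to the sharp `L¹`-Sobolev inequality and the fact -/

section Glue

set_option maxHeartbeats 3200000 in
/-- **`sharpLogSobolevAVR_four` from the (super)solvability of Brendle's Neumann problem**
(Brendle, CPAM 76 (2023), Thm. 1.1 and §2; Balogh–Kristály–Tripaldi Thm. 1.1 via §3.1),
supersolution form: the PDE is only required as the inequality `f Δu + ⟨∇f, ∇u⟩ ≤ F` on `D`
(Brendle's Lemma 2.1 uses nothing more). If on the data of
the fact the Neumann–ABP solvability schema `HPDE` of the module docstring holds (Brendle §2: the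
linear Neumann problem `div(f∇u) = F`, `∂_η u = β ≥ 1`, GT Thm. 6.31, and "the minimum is not
attained on the boundary"), then `sharpLogSobolevAVR_four` holds: Brendle's Lemma 2.1, the
normalisation by `λ`, the ABP volume estimate `abp_volume_estimate_of_contact`, the regularisation
`f = √(φ² + δ²)`, `s = √(|∇f|² + τ²)` and `δ, τ → 0` give the sharp `L¹`-Sobolev inequality for
`C_c^∞` functions, and `sharpLogSobolevAVR_four_of_l1Sobolev` concludes. See the module docstring.
[cite: Brendle2022, Thm. 1.1 (proof, §2)] [cite: BaloghKristalyTripaldi2024, Thm. 1.1] -/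
theorem sharpLogSobolevAVR_four_of_neumannABP_le
    (HPDE : ∀ (P : Type) [TopologicalSpace P] [T2Space P] [SecondCountableTopology P]
      [ChartedSpace (EuclideanSpace ℝ (Fin 4)) P] [IsManifold (𝓡 4) ∞ P] [ConnectedSpace P]
      [T3Space P] [MeasurableSpace P] [BorelSpace P]
      (h : PseudoRiemannianMetric (𝓡 4) ∞ (EuclideanSpace ℝ (Fin 4))
        (TangentSpace (𝓡 4) : P → Type _))
      [h.HasLeviCivita] (hh : h.IsRiemannian) (θ : ℝ),
      (∀ (x : P) (r : NNReal), IsCompact {y : P | h.edist hh x y ≤ r}) →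
      (∀ (x : P) (X : TangentSpace (𝓡 4) x), 0 ≤ h.ricci x X X) → 0 < θ →
      (∀ x : P, Tendsto (fun r : ℝ ↦
        ((riemannianMeasure (h.toContMDiffRiemannianMetric hh))
          {y : P | h.edist hh x y ≤ ENNReal.ofReal r}).toReal / (Real.pi ^ 2 / 2 * r ^ 4))
        atTop (𝓝 θ)) →
      ∀ K : Set P, IsCompact K → ∃ (D : Set P) (σ : ℝ), IsOpen D ∧ K ⊆ D ∧
        IsCompact (closure D) ∧ 0 ≤ σ ∧
        ∀ (f F : P → ℝ) (c : ℝ), ContMDiff (𝓡 4) 𝓘(ℝ, ℝ) ∞ f → ContMDiff (𝓡 4) 𝓘(ℝ, ℝ) ∞ F →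
          (∀ x, 0 < f x) → (∀ x, x ∉ K → f x = c) →
          c * σ ≤ ∫ x in D, F x ∂(riemannianMeasure (h.toContMDiffRiemannianMetric hh)) →
          ∃ u : P → ℝ, ContMDiff (𝓡 4) 𝓘(ℝ, ℝ) ∞ u ∧
            (∀ x ∈ D, f x * h.dalembertian u x + h.val x (grad h f x) (grad h u x) ≤ F x) ∧
            (∀ r : ℝ, 0 < r → ∀ p : P, (∀ x ∈ closure D, h.edist hh x p < ENNReal.ofReal r) →
              ∃ x₁ ∈ D, ∀ x ∈ closure D, r * u x₁ + 1 / 2 * (h.edist hh x₁ p).toReal ^ 2 ≤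
                r * u x + 1 / 2 * (h.edist hh x p).toReal ^ 2)) :
    sharpLogSobolevAVR_four := by
  refine sharpLogSobolevAVR_four_of_l1Sobolev ?_
  intro P _ _ _ _ _ _ _ _ _ h _ hh θ hcpt hRic hθ havr φ hφ hφc
  set μ : Measure P := riemannianMeasure (h.toContMDiffRiemannianMetric hh) with hμ
  haveI : IsFiniteMeasureOnCompacts μ :=
    ⟨fun K hK ↦ riemannianVolume_lt_top_of_isCompact_holds _ le_rfl hK⟩
  -- nonnegativity and continuity facts
  have hgs0 : ∀ (ψ : P → ℝ) (x : P), 0 ≤ h.gradSq ψ x := fun ψ x ↦ by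
    rw [gradSq_eq_val_grad]
    by_cases hz : grad h ψ x = 0
    · rw [hz]; simp
    · exact (hh x _ hz).le
  have hφcont : Continuous φ := hφ.continuous
  have hgφc : Continuous fun x ↦ Real.sqrt (h.gradSq φ x) :=
    Real.continuous_sqrt.comp (contMDiff_gradSq h hφ).continuous
  have hgsupp : HasCompactSupport (h.gradSq φ) := by
    refine hφc.mono' fun x hx ↦ ?_
    by_contra hx'
    exact hx (gradSq_eq_zero_of_notMem_tsupport' h hx')
  have hG₀i : Integrable (fun x ↦ Real.sqrt (h.gradSq φ x)) μ :=
    hgφc.integrable_of_hasCompactSupport (hgsupp.comp_left Real.sqrt_zero)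
  -- the domain and the boundary constant
  obtain ⟨D, σ, hDo, hKD, hDc, hσ, hsolve⟩ := HPDE P h hh θ hcpt hRic hθ havr (tsupport φ) hφc
  have hφD : ∀ x, x ∉ D → φ x = 0 := fun x hx ↦
    image_eq_zero_of_notMem_tsupport fun h' ↦ hx (hKD h')
  have hDfin : μ D < ⊤ := lt_of_le_of_lt (measure_mono subset_closure) hDc.measure_lt_top
  have hint : ∀ w : P → ℝ, Continuous w → IntegrableOn w D μ := fun w hw ↦
    (hw.continuousOn.integrableOn_compact hDc).mono_set subset_closure
  -- the two global integrals against integrals over `D`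
  set I₀ : ℝ := ∫ x, |φ x| ^ (4 / 3 : ℝ) ∂μ with hI₀
  set G₀ : ℝ := ∫ x, Real.sqrt (h.gradSq φ x) ∂μ with hG₀
  have hI₀D : I₀ = ∫ x in D, |φ x| ^ (4 / 3 : ℝ) ∂μ := by
    rw [hI₀, ← setIntegral_eq_integral_of_forall_compl_eq_zero]
    intro x hx
    rw [hφD x hx, abs_zero, Real.zero_rpow (by norm_num)]
  have hI₀nn : 0 ≤ I₀ := integral_nonneg fun x ↦ Real.rpow_nonneg (abs_nonneg _) _
  have hG₀D : ∫ x in D, Real.sqrt (h.gradSq φ x) ∂μ ≤ G₀ :=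
    setIntegral_le_integral hG₀i (Eventually.of_forall fun x ↦ Real.sqrt_nonneg _)
  have hG₀nn : 0 ≤ G₀ := integral_nonneg fun x ↦ Real.sqrt_nonneg _
  set c₁ : ℝ := (Real.pi ^ 2 / 2) ^ (1 / 4 : ℝ) with hc₁
  have hc₁nn : 0 ≤ c₁ := Real.rpow_nonneg (by positivity) _
  -- the main estimate for fixed `δ, τ > 0`
  have hmain : ∀ δ : ℝ, 0 < δ → ∀ τ : ℝ, 0 < τ →
      4 * c₁ * θ ^ (1 / 4 : ℝ) * I₀ ^ (3 / 4 : ℝ) ≤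
        G₀ + τ * (μ D).toReal + δ * σ := by
    intro δ hδ τ hτ
    -- the positive regularisation `f = √(φ² + δ²)`
    set f : P → ℝ := fun x ↦ Real.sqrt (φ x ^ 2 + δ ^ 2) with hf_def
    have hf : ContMDiff (𝓡 4) 𝓘(ℝ, ℝ) ∞ f := contMDiff_sqrt_sq_add_sq hφ hδ
    have hfδ : ∀ x, δ ≤ f x := fun x ↦ by
      show δ ≤ Real.sqrt (φ x ^ 2 + δ ^ 2)
      rw [Real.le_sqrt hδ.le (by positivity)]
      nlinarith
    have hfpos : ∀ x, 0 < f x := fun x ↦ hδ.trans_le (hfδ x)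
    have hfK : ∀ x, x ∉ tsupport φ → f x = δ := fun x hx ↦ by
      show Real.sqrt (φ x ^ 2 + δ ^ 2) = δ
      rw [image_eq_zero_of_notMem_tsupport hx, zero_pow two_ne_zero, zero_add, Real.sqrt_sq hδ.le]
    have hφf : ∀ x, |φ x| ≤ f x := fun x ↦ by
      show |φ x| ≤ Real.sqrt (φ x ^ 2 + δ ^ 2)
      rw [← Real.sqrt_sq_eq_abs]
      exact Real.sqrt_le_sqrt (by nlinarith)
    have hgf : ∀ x, h.gradSq f x ≤ h.gradSq φ x := fun x ↦
      gradSq_sqrt_sq_add_sq_le_gradSq h hh (hφ.mdifferentiableAt (by simp)) hδ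
    have hfc : Continuous f := hf.continuous
    -- the smoothed gradient length `s = √(|∇f|² + τ²)`
    set s : P → ℝ := fun x ↦ Real.sqrt (h.gradSq f x + τ ^ 2) with hs_def
    have hs : ContMDiff (𝓡 4) 𝓘(ℝ, ℝ) ∞ s :=
      contMDiff_sqrt_of_pos ((contDiff_id.add contDiff_const).comp_contMDiff
        (contMDiff_gradSq h hf)) fun x ↦ by
          show 0 < h.gradSq f x + τ ^ 2
          nlinarith [hgs0 f x, sq_nonneg τ, hτ]
    have hsc : Continuous s := hs.continuous
    have hs_ge : ∀ x, Real.sqrt (h.gradSq f x) ≤ s x := fun x ↦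
      Real.sqrt_le_sqrt (by nlinarith)
    have hs_τ : ∀ x, τ ≤ s x := fun x ↦ by
      show τ ≤ Real.sqrt (h.gradSq f x + τ ^ 2)
      rw [Real.le_sqrt hτ.le (by nlinarith [hgs0 f x, sq_nonneg τ])]
      nlinarith [hgs0 f x]
    have hs_le : ∀ x, s x ≤ Real.sqrt (h.gradSq φ x) + τ := fun x ↦ by
      show Real.sqrt (h.gradSq f x + τ ^ 2) ≤ Real.sqrt (h.gradSq φ x) + τ
      rw [Real.sqrt_le_left (by positivity)]
      have h1 : Real.sqrt (h.gradSq φ x) ^ 2 = h.gradSq φ x := Real.sq_sqrt (hgs0 φ x)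
      nlinarith [Real.sqrt_nonneg (h.gradSq φ x), hgf x]
    -- the two integrals over `D`
    set I : ℝ := ∫ x in D, f x ^ (4 / 3 : ℝ) ∂μ with hI_def
    set S : ℝ := ∫ x in D, s x ∂μ with hS_def
    have hfpc : Continuous fun x ↦ f x ^ (4 / 3 : ℝ) :=
      hfc.rpow_const fun x ↦ Or.inl (hfpos x).ne'
    have hI0 : 0 ≤ I := setIntegral_nonneg hDo.measurableSet fun x _ ↦
      Real.rpow_nonneg (hfpos x).le _
    have hS0 : 0 ≤ S := setIntegral_nonneg hDo.measurableSet fun x _ ↦ Real.sqrt_nonneg _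
    have hIge : I₀ ≤ I := by
      rw [hI₀D]
      exact setIntegral_mono_on (hint _ ((continuous_abs.comp hφcont).rpow_const
        fun x ↦ Or.inr (by norm_num))) (hint _ hfpc) hDo.measurableSet
        fun x _ ↦ Real.rpow_le_rpow (abs_nonneg _) (hφf x) (by norm_num)
    have hSle : S ≤ G₀ + τ * (μ D).toReal := by
      have h1 : S ≤ ∫ x in D, (Real.sqrt (h.gradSq φ x) + τ) ∂μ :=
        setIntegral_mono_on (hint _ hsc) (hint _ (hgφc.add continuous_const))
          hDo.measurableSet fun x _ ↦ hs_le x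
      have h2 : ∫ x in D, (Real.sqrt (h.gradSq φ x) + τ) ∂μ =
          (∫ x in D, Real.sqrt (h.gradSq φ x) ∂μ) + τ * (μ D).toReal := by
        rw [integral_add (hint _ hgφc) (hint _ continuous_const), setIntegral_const, smul_eq_mul,
          mul_comm]
        rfl
      linarith
    have hSτ : τ * (μ D).toReal ≤ S := by
      have h1 : ∫ x in D, τ ∂μ ≤ S :=
        setIntegral_mono_on (hint _ continuous_const) (hint _ hsc) hDo.measurableSet
          fun x _ ↦ hs_τ x
      rw [setIntegral_const, smul_eq_mul, mul_comm] at h1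
      exact h1
    -- the degenerate case `I = 0`
    rcases hI0.eq_or_lt with hI | hI
    · have hI₀0 : I₀ = 0 := le_antisymm (hIge.trans_eq hI.symm) hI₀nn
      rw [hI₀0, Real.zero_rpow (by norm_num), mul_zero]
      have : 0 ≤ τ * (μ D).toReal := by positivity
      nlinarith [mul_nonneg hδ.le hσ]
    -- `μ D > 0`, a point of `D`, and the normalising constant `λ`
    have hμD : 0 < (μ D).toReal := by
      rw [ENNReal.toReal_pos_iff]
      refine ⟨pos_iff_ne_zero.2 fun h0 ↦ ?_, hDfin⟩
      have : I = 0 := by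
        rw [hI_def, Measure.restrict_eq_zero.2 h0, integral_zero_measure]
      exact hI.ne' this
    obtain ⟨x₀, hx₀⟩ : D.Nonempty := nonempty_of_measure_ne_zero fun h0 ↦ by
      rw [h0, ENNReal.toReal_zero] at hμD; exact lt_irrefl _ hμD
    set lam : ℝ := (S + δ * σ) / (4 * I) with hlam
    have hT0 : 0 < S + δ * σ := by nlinarith [mul_nonneg hδ.le hσ, mul_pos hτ hμD]
    have hlam0 : 0 < lam := div_pos hT0 (by linarith)
    have hlamI : lam * (4 * I) = S + δ * σ := div_mul_cancel₀ _ (by linarith)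
    -- the right-hand side `F = 4λ f^{4/3} − s` and the compatibility
    set F : P → ℝ := fun x ↦ 4 * lam * f x ^ (4 / 3 : ℝ) - s x with hF_def
    have hF : ContMDiff (𝓡 4) 𝓘(ℝ, ℝ) ∞ F :=
      (contMDiff_const.mul (contMDiff_rpow_const_of_pos hf hfpos _)).sub hs
    have hcompat : δ * σ ≤ ∫ x in D, F x ∂μ := by
      have h1 : ∫ x in D, F x ∂μ = 4 * lam * I - S := by
        show ∫ x in D, (4 * lam * f x ^ (4 / 3 : ℝ) - s x) ∂μ = _
        rw [integral_sub ((hint _ hfpc).const_mul _) (hint _ hsc), integral_const_mul]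
      rw [h1]
      nlinarith
    -- the solution `u` of the Neumann–ABP problem
    obtain ⟨u, hu, hpdeq, hcont⟩ := hsolve f F δ hf hF hfpos hfK hcompat
    -- Lemma 2.1: `Δu ≤ 4 λ f^{1/3}` on `D ∩ {|∇u| < 1}`
    set κ : P → ℝ := fun x ↦ lam * f x ^ (1 / 3 : ℝ) with hκ_def
    have hκc : Continuous κ := continuous_const.mul (hfc.rpow_const fun x ↦ Or.inl (hfpos x).ne')
    have hκ0 : ∀ x, 0 ≤ κ x := fun x ↦ mul_nonneg hlam0.le (Real.rpow_nonneg (hfpos x).le _)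
    have hpde : ∀ x ∈ D, h.gradSq u x < 1 → h.dalembertian u x ≤ (4 : ℕ) * κ x := by
      intro x hx hgu
      have heq := hpdeq x hx
      -- Cauchy–Schwarz: `-g(∇f, ∇u) ≤ |∇f| |∇u| ≤ |∇f| ≤ s`
      have hpos' : ∀ (y : P) (v : TangentSpace (𝓡 4) y), 0 ≤ h.val y v v := fun y v ↦ by
        by_cases hv : v = 0
        · rw [hv]; simp
        · exact (hh y v hv).le
      have hCS := abs_val_le_sqrt_mul_sqrt h hpos' x (grad h f x) (grad h u x)
      rw [← gradSq_eq_val_grad, ← gradSq_eq_val_grad] at hCS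
      have hgu1 : Real.sqrt (h.gradSq u x) ≤ 1 := by
        rw [Real.sqrt_le_one]; exact hgu.le
      have h1 : -(h.val x (grad h f x) (grad h u x)) ≤ s x := by
        have h2 : |h.val x (grad h f x) (grad h u x)| ≤ Real.sqrt (h.gradSq f x) := by
          calc |h.val x (grad h f x) (grad h u x)|
              ≤ Real.sqrt (h.gradSq f x) * Real.sqrt (h.gradSq u x) := hCS
            _ ≤ Real.sqrt (h.gradSq f x) * 1 :=
                mul_le_mul_of_nonneg_left hgu1 (Real.sqrt_nonneg _)
            _ = Real.sqrt (h.gradSq f x) := mul_one _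
        linarith [neg_abs_le (h.val x (grad h f x) (grad h u x)), hs_ge x]
      have h3 : f x * h.dalembertian u x ≤ 4 * lam * f x ^ (4 / 3 : ℝ) := by
        have : f x * h.dalembertian u x ≤ 4 * lam * f x ^ (4 / 3 : ℝ) - s x -
            h.val x (grad h f x) (grad h u x) := by
          show _ ≤ F x - _
          linarith
        linarith
      have h4 : f x ^ (4 / 3 : ℝ) = f x * f x ^ (1 / 3 : ℝ) := by
        rw [show (4 / 3 : ℝ) = 1 + 1 / 3 by norm_num, Real.rpow_add (hfpos x), Real.rpow_one]
      rw [h4] at h3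
      have h5 : f x * h.dalembertian u x ≤ f x * ((4 : ℕ) * κ x) := by
        have : 4 * lam * (f x * f x ^ (1 / 3 : ℝ)) = f x * ((4 : ℕ) * κ x) := by
          push_cast; simp only [hκ_def]; ring
        rw [← this]; exact h3
      exact le_of_mul_le_mul_left h5 (hfpos x)
    -- the ABP volume estimate
    have hABP := abp_volume_estimate_of_contact h (m := 4) (by norm_num) hh hcpt hRic
      (cB := Real.pi ^ 2 / 2) (by positivity) x₀ (havr x₀) hDo hDc hu hκc hκ0 hpde hcont
    -- `∫_U κ⁴ ≤ λ⁴ I`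
    have hκ4 : ∀ x, κ x ^ 4 = lam ^ 4 * f x ^ (4 / 3 : ℝ) := fun x ↦ by
      simp only [hκ_def, mul_pow]
      congr 1
      rw [← Real.rpow_natCast (f x ^ (1 / 3 : ℝ)) 4, ← Real.rpow_mul (hfpos x).le]
      norm_num
    have hU : ∫ x in {x | x ∈ D ∧ h.gradSq u x < 1}, κ x ^ 4 ∂μ ≤ lam ^ 4 * I := by
      have h1 : ∫ x in {x | x ∈ D ∧ h.gradSq u x < 1}, κ x ^ 4 ∂μ ≤ ∫ x in D, κ x ^ 4 ∂μ :=
        setIntegral_mono_set (hint _ (hκc.pow 4))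
          (Eventually.of_forall fun x ↦ pow_nonneg (hκ0 x) 4)
          (Eventually.of_forall fun x hx ↦ hx.1)
      have h2 : ∫ x in D, κ x ^ 4 ∂μ = lam ^ 4 * I := by
        simp_rw [hκ4]
        rw [integral_const_mul]
      linarith
    have hkey : θ * (Real.pi ^ 2 / 2) ≤ lam ^ 4 * I := hABP.trans hU
    -- algebra: `4 c₁ θ^{1/4} I^{3/4} ≤ S + δσ`
    have hθ4 : (θ ^ (1 / 4 : ℝ)) ^ 4 = θ := by
      rw [← Real.rpow_natCast, ← Real.rpow_mul hθ.le]; norm_num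
    have hc₁4 : c₁ ^ 4 = Real.pi ^ 2 / 2 := by
      rw [hc₁, ← Real.rpow_natCast, ← Real.rpow_mul (by positivity)]; norm_num
    have hI4 : (I ^ (3 / 4 : ℝ)) ^ 4 = I ^ 3 := by
      rw [← Real.rpow_natCast, ← Real.rpow_mul hI.le]; norm_num
    have hstep : 4 * c₁ * θ ^ (1 / 4 : ℝ) * I ^ (3 / 4 : ℝ) ≤ S + δ * σ := by
      refine le_of_pow_le_pow_left₀ (by norm_num : (4 : ℕ) ≠ 0) hT0.le ?_
      have h1 : (4 * c₁ * θ ^ (1 / 4 : ℝ) * I ^ (3 / 4 : ℝ)) ^ 4 =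
          4 ^ 4 * (Real.pi ^ 2 / 2) * θ * I ^ 3 := by
        rw [mul_pow, mul_pow, mul_pow, hθ4, hc₁4, hI4]
      have h2 : (S + δ * σ) ^ 4 = 4 ^ 4 * lam ^ 4 * I ^ 4 := by
        rw [← hlamI]; ring
      rw [h1, h2]
      have h3 : 0 ≤ (4 : ℝ) ^ 4 * I ^ 3 := by positivity
      nlinarith [mul_le_mul_of_nonneg_left hkey h3]
    -- conclusion
    have hmono : 4 * c₁ * θ ^ (1 / 4 : ℝ) * I₀ ^ (3 / 4 : ℝ) ≤
        4 * c₁ * θ ^ (1 / 4 : ℝ) * I ^ (3 / 4 : ℝ) :=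
      mul_le_mul_of_nonneg_left (Real.rpow_le_rpow hI₀nn hIge (by norm_num))
        (by positivity)
    linarith
  -- let `δ → 0`, then `τ → 0`
  have hτ : ∀ τ : ℝ, 0 < τ → 4 * c₁ * θ ^ (1 / 4 : ℝ) * I₀ ^ (3 / 4 : ℝ) ≤
      G₀ + τ * (μ D).toReal := by
    intro τ hτ
    refine le_of_forall_pos_le_add fun ε hε ↦ ?_
    have h1 := hmain (ε / (σ + 1)) (by positivity) τ hτ
    have h2 : ε / (σ + 1) * σ ≤ ε := by
      rw [div_mul_eq_mul_div, div_le_iff₀ (by linarith)]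
      nlinarith
    linarith
  show 4 * (Real.pi ^ 2 / 2) ^ (1 / 4 : ℝ) * θ ^ (1 / 4 : ℝ) * I₀ ^ (3 / 4 : ℝ) ≤ G₀
  refine le_of_forall_pos_le_add fun ε hε ↦ ?_
  have h1 := hτ (ε / ((μ D).toReal + 1)) (by positivity)
  have h2 : ε / ((μ D).toReal + 1) * (μ D).toReal ≤ ε := by
    rw [div_mul_eq_mul_div, div_le_iff₀ (by positivity)]
    nlinarith [ENNReal.toReal_nonneg (a := μ D)]
  linarith

/-- **`sharpLogSobolevAVR_four` from the solvability of Brendle's Neumann problem** (equation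
form of `sharpLogSobolevAVR_four_of_neumannABP_le`: the PDE `f Δu + ⟨∇f, ∇u⟩ = F` on `D`, as in
Brendle, CPAM 76 (2023), §2). See the module docstring for the schema `HPDE`.
[cite: Brendle2022, Thm. 1.1 (proof, §2)] [cite: BaloghKristalyTripaldi2024, Thm. 1.1] -/
theorem sharpLogSobolevAVR_four_of_neumannABP
    (HPDE : ∀ (P : Type) [TopologicalSpace P] [T2Space P] [SecondCountableTopology P]
      [ChartedSpace (EuclideanSpace ℝ (Fin 4)) P] [IsManifold (𝓡 4) ∞ P] [ConnectedSpace P]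
      [T3Space P] [MeasurableSpace P] [BorelSpace P]
      (h : PseudoRiemannianMetric (𝓡 4) ∞ (EuclideanSpace ℝ (Fin 4))
        (TangentSpace (𝓡 4) : P → Type _))
      [h.HasLeviCivita] (hh : h.IsRiemannian) (θ : ℝ),
      (∀ (x : P) (r : NNReal), IsCompact {y : P | h.edist hh x y ≤ r}) →
      (∀ (x : P) (X : TangentSpace (𝓡 4) x), 0 ≤ h.ricci x X X) → 0 < θ →
      (∀ x : P, Tendsto (fun r : ℝ ↦
        ((riemannianMeasure (h.toContMDiffRiemannianMetric hh))
          {y : P | h.edist hh x y ≤ ENNReal.ofReal r}).toReal / (Real.pi ^ 2 / 2 * r ^ 4))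
        atTop (𝓝 θ)) →
      ∀ K : Set P, IsCompact K → ∃ (D : Set P) (σ : ℝ), IsOpen D ∧ K ⊆ D ∧
        IsCompact (closure D) ∧ 0 ≤ σ ∧
        ∀ (f F : P → ℝ) (c : ℝ), ContMDiff (𝓡 4) 𝓘(ℝ, ℝ) ∞ f → ContMDiff (𝓡 4) 𝓘(ℝ, ℝ) ∞ F →
          (∀ x, 0 < f x) → (∀ x, x ∉ K → f x = c) →
          c * σ ≤ ∫ x in D, F x ∂(riemannianMeasure (h.toContMDiffRiemannianMetric hh)) →
          ∃ u : P → ℝ, ContMDiff (𝓡 4) 𝓘(ℝ, ℝ) ∞ u ∧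
            (∀ x ∈ D, f x * h.dalembertian u x + h.val x (grad h f x) (grad h u x) = F x) ∧
            (∀ r : ℝ, 0 < r → ∀ p : P, (∀ x ∈ closure D, h.edist hh x p < ENNReal.ofReal r) →
              ∃ x₁ ∈ D, ∀ x ∈ closure D, r * u x₁ + 1 / 2 * (h.edist hh x₁ p).toReal ^ 2 ≤
                r * u x + 1 / 2 * (h.edist hh x p).toReal ^ 2)) :
    sharpLogSobolevAVR_four := by
  refine sharpLogSobolevAVR_four_of_neumannABP_le ?_
  intro P _ _ _ _ _ _ _ _ _ h _ hh θ hcpt hRic hθ havr K hK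
  obtain ⟨D, σ, hDo, hKD, hDc, hσ, hsolve⟩ := HPDE P h hh θ hcpt hRic hθ havr K hK
  refine ⟨D, σ, hDo, hKD, hDc, hσ, fun f F c hf hF hpos hfK hcompat ↦ ?_⟩
  obtain ⟨u, hu, hpde, hcont⟩ := hsolve f F c hf hF hpos hfK hcompat
  exact ⟨u, hu, fun x hx ↦ (hpde x hx).le, hcont⟩

end Glue

/-! ### The contact property from the Neumann inequality, and the Neumann form of the glue -/

section NeumannContact

variable {E : Type*} [NormedAddCommGroup E] [NormedSpace ℝ E] [FiniteDimensional ℝ E]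
  [CompleteSpace E] {H : Type*} [TopologicalSpace H] {I : ModelWithCorners ℝ E H}
  {M : Type*} [TopologicalSpace M] [ChartedSpace H M] [IsManifold I ∞ M] [T2Space M]
  [I.Boundaryless]
  (g : PseudoRiemannianMetric I ∞ E (TangentSpace I : M → Type _)) [g.HasLeviCivita]
  [CovariantDerivative.ContMDiffCovariantDerivative g.leviCivita 1]
  [CovariantDerivative.ContMDiffCovariantDerivative g.leviCivita ∞]

omit [FiniteDimensional ℝ E] [CompleteSpace E] [IsManifold I ∞ M] [T2Space M] [I.Boundaryless] in
/-- The derivative of `f ∘ γ` at `t` is `df(γ'(t))` for `f` and `γ` differentiable. [folklore] -/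
theorem hasDerivAt_comp_curve_of_mdifferentiableAt {f : M → ℝ} {γ : ℝ → M} {t : ℝ}
    (hf : MDifferentiableAt I 𝓘(ℝ, ℝ) f (γ t)) (hγ : MDifferentiableAt 𝓘(ℝ, ℝ) I γ t) :
    HasDerivAt (f ∘ γ) (mvfderiv I f (γ t) (velocity I γ t)) t := by
  have h0 : HasFDerivAt (f ∘ γ)
      (show ℝ →L[ℝ] ℝ from (mfderiv I 𝓘(ℝ, ℝ) f (γ t)).comp (mfderiv 𝓘(ℝ, ℝ) I γ t)) t :=
    (hf.hasMFDerivAt.comp t hγ.hasMFDerivAt).hasFDerivAt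
  exact h0.hasDerivAt

omit [FiniteDimensional ℝ E] [CompleteSpace E] [IsManifold I ∞ M] [T2Space M] [I.Boundaryless]
  [g.HasLeviCivita] in
/-- Congruence of `mvfderiv I f q v` under a propositional equality of base points (the fibres
`T_q M` are all the model space `E`). [folklore] -/
theorem mvfderiv_congr_point' {f : M → ℝ} {q q' : M} (hq : q = q') {v : TangentSpace I q}
    {v' : TangentSpace I q'} (hv : (v : E) = (v' : E)) :
    mvfderiv I f q v = mvfderiv I f q' v' := by
  subst hq
  have : v = v' := hv
  rw [this]

/-- **The inward geodesic at a boundary point of `{σ ≤ 0}`** (the curve used in Brendle's remark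
"since `⟨∇u, η⟩ = 1` the minimum is not attained on the boundary", CPAM 76 (2023), proof of
Lemma 2.2): on a complete manifold, for smooth `σ, u` and a point `x`, the geodesic
`γ(t) = exp_x(-t ∇σ(x))` satisfies `γ 0 = x`, `d(x, γ t) ≤ t |∇σ(x)|` for `t ≥ 0` (constant speed
and `edist_le_length`), `(σ ∘ γ)'(0) = -|∇σ(x)|²` and `(u ∘ γ)'(0) = -g(∇u(x), ∇σ(x))`.
[cite: Brendle2022, Lemma 2.2 (proof)] -/
theorem exists_inward_curve (hg : g.IsRiemannian) (hc : IsGeodesicallyComplete g.leviCivita)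
    {σ : M → ℝ} (hσ : ContMDiff I 𝓘(ℝ, ℝ) ∞ σ) (u : M → ℝ) (hu : ContMDiff I 𝓘(ℝ, ℝ) ∞ u)
    (x : M) :
    ∃ γ : ℝ → M, γ 0 = x ∧ Continuous γ ∧
      (∀ t, 0 ≤ t → g.edist hg x (γ t) ≤ ENNReal.ofReal (t * Real.sqrt (g.gradSq σ x))) ∧
      HasDerivAt (σ ∘ γ) (-g.gradSq σ x) 0 ∧
      HasDerivAt (u ∘ γ) (-g.val x (grad g u x) (grad g σ x)) 0 := by
  haveI : Fact ((1 : ℕ∞ω) ≤ ∞) := ⟨by exact_mod_cast le_top⟩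
  have hnn : ∀ (y : M) (v' : TangentSpace I y), 0 ≤ g.val y v' v' := fun y v' ↦ by
    by_cases hv : v' = 0
    · subst hv; simp
    · exact (hg y v' hv).le
  set v : TangentSpace I x := -grad g σ x with hv_def
  set γ : ℝ → M := fun t ↦ expMap g.leviCivita x (t • v) with hγ_def
  have hγs : ContMDiff 𝓘(ℝ, ℝ) I ∞ γ :=
    (contMDiff_expMap_of_isGeodesicallyComplete (cov := g.leviCivita) (k := (⊤ : ℕ∞)) le_top hc
      x).comp ((contDiff_id.smul contDiff_const).contMDiff)
  have hgeo : IsGeodesic g.leviCivita γ :=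
    isGeodesic_expMap_smul_of_isGeodesicallyComplete hc x v
  have hγ0 : γ 0 = x := by
    show expMap g.leviCivita x ((0 : ℝ) • v) = x
    rw [zero_smul]; exact expMap_zero (cov := g.leviCivita) x
  have hvv : g.val x v v = g.gradSq σ x := by
    simp only [hv_def, map_neg, neg_apply, neg_neg]
    rw [val_grad]; rfl
  have hv0 : (velocity I γ 0 : E) = (v : E) := velocity_expMap_smul_zero x v
  -- constant speed
  have hspeed : ∀ t, g.val (γ t) (velocity I γ t) (velocity I γ t) = g.gradSq σ x := by
    intro t
    have h := g.val_velocity_eq_of_isGeodesicOn_holds isOpen_univ ordConnected_univ hgeo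
      (mem_univ t) (mem_univ 0)
    rw [h]
    have h2 : g.val (γ 0) (velocity I γ 0) (velocity I γ 0) = g.val x v v := by
      have key : ∀ (q : M) (hq : q = x) (w : TangentSpace I q), (w : E) = (v : E) →
          g.val q w w = g.val x v v := by
        intro q hq w hw
        subst hq
        have : w = v := hw
        rw [this]
      exact key (γ 0) hγ0 _ hv0
    rw [h2, hvv]
  refine ⟨γ, hγ0, hγs.continuous, fun t ht ↦ ?_, ?_, ?_⟩
  · -- `d(x, γ t) ≤ L(γ|[0,t]) = t |∇σ|`
    have h1le : (1 : ℕ∞ω) ≤ ∞ := by exact_mod_cast le_top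
    have hc₁ : ContMDiffOn 𝓘(ℝ, ℝ) I 1 γ (Icc 0 t) := (hγs.of_le h1le).contMDiffOn
    have hle := g.edist_le_length hg ht hc₁
    rw [hγ0] at hle
    have hfc : Continuous fun s ↦ g.val (γ s) (velocity I γ s) (velocity I γ s) := by
      simp_rw [hspeed]; exact continuous_const
    rw [length_eq_ofReal_integral g hg ht hfc] at hle
    refine hle.trans (le_of_eq ?_)
    congr 1
    simp_rw [hspeed]
    rw [intervalIntegral.integral_const, smul_eq_mul, sub_zero]
  · -- `(σ ∘ γ)'(0) = dσ(v) = -|∇σ|²`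
    have h := hasDerivAt_comp_curve_of_mdifferentiableAt (I := I) (f := σ) (γ := γ) (t := 0)
      ((hσ _).mdifferentiableAt (by simp)) ((hγs 0).mdifferentiableAt (by simp))
    have h2 : mvfderiv I σ (γ 0) (velocity I γ 0) = -g.gradSq σ x := by
      rw [mvfderiv_congr_point' hγ0 hv0, ← val_grad, g.symm x, hv_def]
      simp only [map_neg, neg_apply]
      rw [val_grad]; rfl
    rwa [h2] at h
  · have h := hasDerivAt_comp_curve_of_mdifferentiableAt (I := I) (f := u) (γ := γ) (t := 0)
      ((hu _).mdifferentiableAt (by simp)) ((hγs 0).mdifferentiableAt (by simp))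
    have h2 : mvfderiv I u (γ 0) (velocity I γ 0) = -g.val x (grad g u x) (grad g σ x) := by
      rw [mvfderiv_congr_point' hγ0 hv0, ← val_grad, hv_def, map_neg]
    rwa [h2] at h

/-- A point with `σ x = 0` and `∇σ(x) ≠ 0` lies in the closure of `{σ < 0}` (move along the
inward geodesic). [folklore] -/
theorem mem_closure_setOf_lt_of_gradSq_pos (hg : g.IsRiemannian)
    (hc : IsGeodesicallyComplete g.leviCivita) {σ : M → ℝ} (hσ : ContMDiff I 𝓘(ℝ, ℝ) ∞ σ)
    {x : M} (hx : σ x = 0) (hgrad : 0 < g.gradSq σ x) : x ∈ closure {y | σ y < 0} := by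
  obtain ⟨γ, hγ0, hγc, -, hσd, -⟩ := exists_inward_curve g hg hc hσ σ hσ x
  -- `σ (γ t) < 0` for small `t > 0`
  have hslope := hσd.tendsto_slope_zero_right
  have hev : ∀ᶠ t in 𝓝[>] (0 : ℝ), σ (γ t) < 0 := by
    have h1 : ∀ᶠ t in 𝓝[>] (0 : ℝ), t⁻¹ • ((σ ∘ γ) (0 + t) - (σ ∘ γ) 0) < 0 :=
      hslope (Iio_mem_nhds (by linarith))
    filter_upwards [h1, self_mem_nhdsWithin] with t ht ht0
    simp only [comp_apply, zero_add, hγ0, hx, sub_zero, smul_eq_mul] at ht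
    have ht0' : (0 : ℝ) < t := ht0
    by_contra hcon
    have hcon' : 0 ≤ σ (γ t) := not_lt.1 hcon
    have : 0 ≤ t⁻¹ * σ (γ t) := mul_nonneg (inv_nonneg.2 ht0'.le) hcon'
    linarith
  have hγt : Tendsto γ (𝓝[>] (0 : ℝ)) (𝓝 x) := by
    rw [← hγ0]; exact hγc.continuousAt.tendsto.mono_left nhdsWithin_le_nhds
  exact mem_closure_of_tendsto hγt hev

/-- **No boundary minimum under the Neumann inequality** (Brendle, CPAM 76 (2023), proof of
Lemma 2.2, first sentence: "Since `⟨∇u, η⟩ = 1`, the function `r u + ½ d(·,p)²` cannot attain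
its minimum on the boundary"). On a complete Riemannian manifold let `σ, u` be smooth with
`{σ ≤ 0}` compact, `{σ < 0}` nonempty, `∇σ ≠ 0` on `{σ = 0}` and the Neumann inequality
`g(∇u, ∇σ) ≥ |∇σ|` (i.e. `∂_η u ≥ 1` for the outer normal `η = ∇σ/|∇σ|`) on `{σ = 0}`. If
`d(x, p) < r` on `{σ ≤ 0}`, then `x ↦ r u(x) + ½ d(x, p)²` attains its minimum over `{σ ≤ 0}` at
a point of `{σ < 0}`: at a boundary minimum `z`, along `γ(t) = exp_z(-t∇σ)` one has
`σ(γ t) < 0`, `u(γ t) ≤ u(z) - t(|∇σ| - ε)` and `d(γ t, p) ≤ d(z, p) + t|∇σ|` (triangle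
inequality), so the value strictly decreases for small `t > 0` because `d(z, p) < r`.
[cite: Brendle2022, Lemma 2.2 (proof)] -/
theorem exists_interior_min_of_neumann [RegularSpace M] (hg : g.IsRiemannian)
    (hc : IsGeodesicallyComplete g.leviCivita) {σ u : M → ℝ} (hσ : ContMDiff I 𝓘(ℝ, ℝ) ∞ σ)
    (hu : ContMDiff I 𝓘(ℝ, ℝ) ∞ u) (hK : IsCompact {x | σ x ≤ 0}) (hne : ∃ x, σ x < 0)
    (hneu : ∀ x, σ x = 0 → Real.sqrt (g.gradSq σ x) ≤ g.val x (grad g u x) (grad g σ x))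
    (hreg : ∀ x, σ x = 0 → 0 < g.gradSq σ x) {r : ℝ} (hr : 0 < r) {p : M}
    (hp : ∀ x, σ x ≤ 0 → g.edist hg x p < ENNReal.ofReal r) :
    ∃ x₁, σ x₁ < 0 ∧ ∀ x, σ x ≤ 0 → r * u x₁ + 1 / 2 * (g.edist hg x₁ p).toReal ^ 2 ≤
      r * u x + 1 / 2 * (g.edist hg x p).toReal ^ 2 := by
  set S : Set M := {x | σ x ≤ 0} with hS
  set G : M → ℝ := fun x ↦ r * u x + 1 / 2 * (g.edist hg x p).toReal ^ 2 with hG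
  -- continuity of `G` on `S` (the distance to `p` is finite there)
  have hGc : ContinuousOn G S := by
    intro x hx
    have hfin : g.edist hg x p ≠ ⊤ := (hp x hx).ne_top
    have h0 : Continuous fun y ↦ g.edist hg y p :=
      (PseudoRiemannianMetric.continuous_edist hg).comp (continuous_id.prodMk continuous_const)
    have h1 : ContinuousAt (fun y ↦ (g.edist hg y p).toReal) x :=
      (ENNReal.continuousAt_toReal hfin).comp (f := fun y ↦ g.edist hg y p) h0.continuousAt
    exact ((continuous_const.mul hu.continuous).continuousAt.add
      (continuousAt_const.mul (h1.pow 2))).continuousWithinAt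
  obtain ⟨x₀, hx₀⟩ := hne
  obtain ⟨z, hzS, hzmin⟩ := hK.exists_isMinOn ⟨x₀, hx₀.le⟩ hGc
  rcases (show σ z ≤ 0 from hzS).lt_or_eq with hz | hz
  · exact ⟨z, hz, fun x hx ↦ hzmin hx⟩
  -- a boundary minimum is impossible: move inwards along `exp_z(-t ∇σ)`
  exfalso
  obtain ⟨γ, hγ0, -, hdist, hσd, hud⟩ := exists_inward_curve g hg hc hσ u hu z
  set N : ℝ := Real.sqrt (g.gradSq σ z) with hN
  have hN2 : 0 < g.gradSq σ z := hreg z hz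
  have hNpos : 0 < N := Real.sqrt_pos.2 hN2
  set d : ℝ := (g.edist hg z p).toReal with hd
  have hdfin : g.edist hg z p ≠ ⊤ := (hp z hzS).ne_top
  have hd0 : 0 ≤ d := ENNReal.toReal_nonneg
  have hdr : d < r := by
    have h := hp z hzS
    rw [← ENNReal.ofReal_toReal hdfin, ENNReal.ofReal_lt_ofReal_iff hr] at h
    exact h
  -- first-order information along `γ`
  set ε : ℝ := N * (r - d) / (4 * r) with hε
  have hεpos : 0 < ε := by
    rw [hε]; exact div_pos (mul_pos hNpos (by linarith)) (by linarith)
  have hev_σ : ∀ᶠ t in 𝓝[>] (0 : ℝ), σ (γ t) < 0 := by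
    have h1 : ∀ᶠ t in 𝓝[>] (0 : ℝ), t⁻¹ • ((σ ∘ γ) (0 + t) - (σ ∘ γ) 0) < 0 :=
      hσd.tendsto_slope_zero_right (Iio_mem_nhds (by linarith))
    filter_upwards [h1, self_mem_nhdsWithin] with t ht ht0
    simp only [comp_apply, zero_add, hγ0, hz, sub_zero, smul_eq_mul] at ht
    have ht0' : (0 : ℝ) < t := ht0
    by_contra hcon
    have : 0 ≤ t⁻¹ * σ (γ t) := mul_nonneg (inv_nonneg.2 ht0'.le) (not_lt.1 hcon)
    linarith
  have hev_u : ∀ᶠ t in 𝓝[>] (0 : ℝ), u (γ t) ≤ u z + t * (-N + ε) := by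
    have hle : -g.val z (grad g u z) (grad g σ z) ≤ -N := by linarith [hneu z hz]
    have h1 : ∀ᶠ t in 𝓝[>] (0 : ℝ), t⁻¹ • ((u ∘ γ) (0 + t) - (u ∘ γ) 0) < -N + ε :=
      hud.tendsto_slope_zero_right (Iio_mem_nhds (by linarith))
    filter_upwards [h1, self_mem_nhdsWithin] with t ht ht0
    simp only [comp_apply, zero_add, hγ0, smul_eq_mul] at ht
    have ht0' : (0 : ℝ) < t := ht0
    have h2 : t⁻¹ * (u (γ t) - u z) * t ≤ (-N + ε) * t :=
      mul_le_mul_of_nonneg_right ht.le ht0'.le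
    have h3 : t⁻¹ * (u (γ t) - u z) * t = u (γ t) - u z := by
      field_simp
    rw [h3] at h2
    linarith
  have hev_t : ∀ᶠ t in 𝓝[>] (0 : ℝ), t < (r - d) / N := by
    have : Iio ((r - d) / N) ∈ 𝓝 (0 : ℝ) := Iio_mem_nhds (div_pos (by linarith) hNpos)
    exact mem_nhdsWithin_of_mem_nhds this
  obtain ⟨t, ⟨hσt, hut, htt⟩, ht0⟩ :=
    ((hev_σ.and (hev_u.and hev_t)).and self_mem_nhdsWithin).exists
  have ht0' : (0 : ℝ) < t := ht0
  -- the distance from `γ t` to `p`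
  have hdt : (g.edist hg (γ t) p).toReal ≤ t * N + d := by
    have h1 : g.edist hg (γ t) p ≤ g.edist hg (γ t) z + g.edist hg z p :=
      PseudoRiemannianMetric.edist_triangle hg _ _ _
    have h2 : g.edist hg (γ t) z ≤ ENNReal.ofReal (t * N) := by
      rw [PseudoRiemannianMetric.edist_comm hg]; exact hdist t ht0'.le
    have h3 : g.edist hg (γ t) p ≤ ENNReal.ofReal (t * N) + ENNReal.ofReal d := by
      rw [hd, ENNReal.ofReal_toReal hdfin]; exact h1.trans (add_le_add_left h2 _)
    have h4 : ENNReal.ofReal (t * N) + ENNReal.ofReal d = ENNReal.ofReal (t * N + d) := by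
      rw [ENNReal.ofReal_add (by positivity) hd0]
    rw [h4] at h3
    exact ENNReal.toReal_le_of_le_ofReal (by positivity) h3
  -- compare `G (γ t)` with `G z`
  have hmin : G z ≤ G (γ t) := hzmin (show σ (γ t) ≤ 0 from hσt.le)
  have hGz : G z = r * u z + 1 / 2 * d ^ 2 := rfl
  have hGt : G (γ t) = r * u (γ t) + 1 / 2 * (g.edist hg (γ t) p).toReal ^ 2 := rfl
  rw [hGz, hGt] at hmin
  have hsq : (g.edist hg (γ t) p).toReal ^ 2 ≤ (t * N + d) ^ 2 :=
    pow_le_pow_left₀ ENNReal.toReal_nonneg hdt 2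
  have hu' : r * u (γ t) ≤ r * (u z + t * (-N + ε)) := mul_le_mul_of_nonneg_left hut hr.le
  -- `r ε = N (r - d) / 4` and `t N ≤ r - d`
  have hrε : r * ε = N * (r - d) / 4 := by
    rw [hε]; field_simp
  have htN : t * N < r - d := by
    have := (lt_div_iff₀ hNpos).1 htt
    linarith
  nlinarith [hmin, hsq, hu', hrε, htN, hNpos, ht0', mul_pos ht0' hNpos, hd0]

/-- For smooth `σ` with `∇σ ≠ 0` on `{σ = 0}` (complete manifold), `closure {σ < 0} = {σ ≤ 0}`.
[folklore] -/
theorem closure_setOf_lt_eq_of_gradSq_pos (hg : g.IsRiemannian)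
    (hc : IsGeodesicallyComplete g.leviCivita) {σ : M → ℝ} (hσ : ContMDiff I 𝓘(ℝ, ℝ) ∞ σ)
    (hreg : ∀ x, σ x = 0 → 0 < g.gradSq σ x) :
    closure {x | σ x < 0} = {x | σ x ≤ 0} := by
  refine Subset.antisymm (closure_minimal (fun x (hx : σ x < 0) ↦ (hx.le : σ x ≤ 0))
    (isClosed_le hσ.continuous continuous_const)) fun x (hx : σ x ≤ 0) ↦ ?_
  rcases hx.lt_or_eq with h | h
  · exact subset_closure h
  · exact mem_closure_setOf_lt_of_gradSq_pos g hg hc hσ h (hreg x h)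

end NeumannContact

section GlueNeumann

set_option maxHeartbeats 1600000 in
/-- **`sharpLogSobolevAVR_four` from the Neumann problem in Brendle's own form** (CPAM 76
(2023), §2, second paragraph: "we can find a function `u : D → ℝ` such that
`div(f∇u) = n f^{n/(n-1)} - |∇f|` in `D` and `⟨∇u, η⟩ = 1` on `∂D` … by standard elliptic
regularity theory `u ∈ C^{2,γ}`", citing Gilbarg–Trudinger Thm. 6.31). Hypothesis `HPDE`: on
the data of the fact, for every compact `K` there are a smooth `σ` with `K ⊆ {σ < 0}`,
`{σ ≤ 0}` compact, `{σ < 0} ≠ ∅`, `∇σ ≠ 0` on `{σ = 0}` (a smooth relatively compact domain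
`D = {σ < 0}` with defining function `σ`) and a constant `A ≥ 0` (think `A = |∂D|`) such that for
all smooth `f > 0` with `f ≡ c` off `K` and smooth `F` with `c A ≤ ∫_D F` there is a smooth `u`
on `P` (a solution smooth up to the boundary, extended) with `f Δu + ⟨∇f, ∇u⟩ ≤ F` on `D` and the
Neumann inequality `g(∇u, ∇σ) ≥ |∇σ|` (`∂_η u ≥ 1`) on `∂D = {σ = 0}`. Then
`sharpLogSobolevAVR_four` holds: `exists_interior_min_of_neumann` converts the Neumann inequality
into the interior-contact property and `sharpLogSobolevAVR_four_of_neumannABP_le` applies.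
[cite: Brendle2022, Thm. 1.1 (proof, §2)] [cite: BaloghKristalyTripaldi2024, Thm. 1.1] -/
theorem sharpLogSobolevAVR_four_of_neumann
    (HPDE : ∀ (P : Type) [TopologicalSpace P] [T2Space P] [SecondCountableTopology P]
      [ChartedSpace (EuclideanSpace ℝ (Fin 4)) P] [IsManifold (𝓡 4) ∞ P] [ConnectedSpace P]
      [T3Space P] [MeasurableSpace P] [BorelSpace P]
      (h : PseudoRiemannianMetric (𝓡 4) ∞ (EuclideanSpace ℝ (Fin 4))
        (TangentSpace (𝓡 4) : P → Type _))
      [h.HasLeviCivita] (hh : h.IsRiemannian) (θ : ℝ),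
      (∀ (x : P) (r : NNReal), IsCompact {y : P | h.edist hh x y ≤ r}) →
      (∀ (x : P) (X : TangentSpace (𝓡 4) x), 0 ≤ h.ricci x X X) → 0 < θ →
      (∀ x : P, Tendsto (fun r : ℝ ↦
        ((riemannianMeasure (h.toContMDiffRiemannianMetric hh))
          {y : P | h.edist hh x y ≤ ENNReal.ofReal r}).toReal / (Real.pi ^ 2 / 2 * r ^ 4))
        atTop (𝓝 θ)) →
      ∀ K : Set P, IsCompact K → ∃ (σ : P → ℝ) (A : ℝ), ContMDiff (𝓡 4) 𝓘(ℝ, ℝ) ∞ σ ∧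
        K ⊆ {x | σ x < 0} ∧ IsCompact {x | σ x ≤ 0} ∧ (∃ x, σ x < 0) ∧
        (∀ x, σ x = 0 → 0 < h.gradSq σ x) ∧ 0 ≤ A ∧
        ∀ (f F : P → ℝ) (c : ℝ), ContMDiff (𝓡 4) 𝓘(ℝ, ℝ) ∞ f → ContMDiff (𝓡 4) 𝓘(ℝ, ℝ) ∞ F →
          (∀ x, 0 < f x) → (∀ x, x ∉ K → f x = c) →
          c * A ≤
            ∫ x in {x | σ x < 0}, F x ∂(riemannianMeasure (h.toContMDiffRiemannianMetric hh)) →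
          ∃ u : P → ℝ, ContMDiff (𝓡 4) 𝓘(ℝ, ℝ) ∞ u ∧
            (∀ x, σ x < 0 → f x * h.dalembertian u x + h.val x (grad h f x) (grad h u x) ≤ F x) ∧
            (∀ x, σ x = 0 → Real.sqrt (h.gradSq σ x) ≤ h.val x (grad h u x) (grad h σ x))) :
    sharpLogSobolevAVR_four := by
  refine sharpLogSobolevAVR_four_of_neumannABP_le ?_
  intro P _ _ _ _ _ _ _ _ _ h _ hh θ hcpt hRic hθ havr K hK
  obtain ⟨σ, A, hσ, hKσ, hKc, hne, hreg, hA, hsolve⟩ := HPDE P h hh θ hcpt hRic hθ havr K hK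
  -- completeness and the smoothness instances of the Levi-Civita connection
  have hk1 : ((1 : ℕ∞) : ℕ∞ω) + 1 ≤ ((⊤ : ℕ∞) : ℕ∞ω) := by
    rw [show ((1 : ℕ∞) : ℕ∞ω) + 1 = 2 by norm_num]
    exact WithTop.coe_le_coe.2 le_top
  haveI : CovariantDerivative.ContMDiffCovariantDerivative h.leviCivita 1 :=
    ⟨h.isLocallyContMDiff_leviCivita_holds 1 hk1 univ isOpen_univ⟩
  haveI : CovariantDerivative.ContMDiffCovariantDerivative h.leviCivita ((⊤ : ℕ∞) : ℕ∞ω) :=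
    ⟨h.isLocallyContMDiff_leviCivita_holds ⊤ (le_of_eq rfl) univ isOpen_univ⟩
  have hc : IsGeodesicallyComplete h.leviCivita :=
    (isGeodesicallyComplete_iff_isCompact_setOf_edist_le h le_rfl hh).2 hcpt
  have hclos : closure {x | σ x < 0} = {x | σ x ≤ 0} :=
    closure_setOf_lt_eq_of_gradSq_pos h hh hc hσ hreg
  refine ⟨{x | σ x < 0}, A, isOpen_lt hσ.continuous continuous_const, hKσ, by rwa [hclos], hA,
    fun f F c hf hF hpos hfK hcompat ↦ ?_⟩
  obtain ⟨u, hu, hpde, hneu⟩ := hsolve f F c hf hF hpos hfK hcompat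
  refine ⟨u, hu, fun x hx ↦ hpde x hx, fun r hr p hp ↦ ?_⟩
  have hp' : ∀ x, σ x ≤ 0 → h.edist hh x p < ENNReal.ofReal r := fun x hx ↦
    hp x (by rw [hclos]; exact hx)
  obtain ⟨x₁, hx₁, hmin⟩ := exists_interior_min_of_neumann h hh hc hσ hu hKc hne hneu hreg hr hp'
  exact ⟨x₁, hx₁, fun x hx ↦ hmin x (by rw [hclos] at hx; exact hx)⟩

end GlueNeumann

/-! ### The final form of the residual: Neumann solvability on given smooth domains -/

section GlueSolvability

set_option maxHeartbeats 800000 in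
/-- **`sharpLogSobolevAVR_four` from the solvability of Brendle's Neumann problem on smooth
relatively compact domains** — the sharpest form of the reduction. Hypothesis `HN` (exactly the
PDE step of Brendle, CPAM 76 (2023), §2, second paragraph, with Gilbarg–Trudinger Thm. 6.31): on
the data of the fact, for EVERY smooth relatively compact regular domain `D = {σ < 0}` of `P`
(`σ` smooth, `{σ ≤ 0}` compact, `{σ < 0} ≠ ∅`, `|∇σ|² > 0` on `{σ = 0}`) there is `A ≥ 0` (think
`A = |∂D|`) such that for all smooth `f > 0` constant `= c` on `{σ ≥ 0}` and all smooth `F` with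
`c A ≤ ∫_D F` the Neumann problem has a smooth supersolution on `P`: `f Δu + ⟨∇f, ∇u⟩ ≤ F` on `D`
and `g(∇u, ∇σ) ≥ |∇σ|` (`∂_η u ≥ 1`) on `∂D`. Then `sharpLogSobolevAVR_four` holds: the domain
containing `K = supp φ` is supplied by `exists_regular_sublevel_domain_gradSq` (smooth exhaustion
function and Sard's theorem) and `sharpLogSobolevAVR_four_of_neumann` applies.
[cite: Brendle2022, Thm. 1.1 (proof, §2)] [cite: BaloghKristalyTripaldi2024, Thm. 1.1] -/
theorem sharpLogSobolevAVR_four_of_neumannSolvability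
    (HN : ∀ (P : Type) [TopologicalSpace P] [T2Space P] [SecondCountableTopology P]
      [ChartedSpace (EuclideanSpace ℝ (Fin 4)) P] [IsManifold (𝓡 4) ∞ P] [ConnectedSpace P]
      [T3Space P] [MeasurableSpace P] [BorelSpace P]
      (h : PseudoRiemannianMetric (𝓡 4) ∞ (EuclideanSpace ℝ (Fin 4))
        (TangentSpace (𝓡 4) : P → Type _))
      [h.HasLeviCivita] (hh : h.IsRiemannian) (θ : ℝ),
      (∀ (x : P) (r : NNReal), IsCompact {y : P | h.edist hh x y ≤ r}) →
      (∀ (x : P) (X : TangentSpace (𝓡 4) x), 0 ≤ h.ricci x X X) → 0 < θ →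
      (∀ x : P, Tendsto (fun r : ℝ ↦
        ((riemannianMeasure (h.toContMDiffRiemannianMetric hh))
          {y : P | h.edist hh x y ≤ ENNReal.ofReal r}).toReal / (Real.pi ^ 2 / 2 * r ^ 4))
        atTop (𝓝 θ)) →
      ∀ σ : P → ℝ, ContMDiff (𝓡 4) 𝓘(ℝ, ℝ) ∞ σ → IsCompact {x | σ x ≤ 0} → (∃ x, σ x < 0) →
        (∀ x, σ x = 0 → 0 < h.gradSq σ x) →
        ∃ A : ℝ, 0 ≤ A ∧
          ∀ (f F : P → ℝ) (c : ℝ), ContMDiff (𝓡 4) 𝓘(ℝ, ℝ) ∞ f →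
            ContMDiff (𝓡 4) 𝓘(ℝ, ℝ) ∞ F → (∀ x, 0 < f x) → (∀ x, 0 ≤ σ x → f x = c) →
            c * A ≤
              ∫ x in {x | σ x < 0}, F x ∂(riemannianMeasure (h.toContMDiffRiemannianMetric hh)) →
            ∃ u : P → ℝ, ContMDiff (𝓡 4) 𝓘(ℝ, ℝ) ∞ u ∧
              (∀ x, σ x < 0 →
                f x * h.dalembertian u x + h.val x (grad h f x) (grad h u x) ≤ F x) ∧
              (∀ x, σ x = 0 → Real.sqrt (h.gradSq σ x) ≤ h.val x (grad h u x) (grad h σ x))) :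
    sharpLogSobolevAVR_four := by
  refine sharpLogSobolevAVR_four_of_neumann ?_
  intro P _ _ _ _ _ _ _ _ _ h _ hh θ hcpt hRic hθ havr K hK
  obtain ⟨σ, hσ, hKσ, hKc, hne, hreg⟩ := exists_regular_sublevel_domain_gradSq h hh hK
  obtain ⟨A, hA, hsolve⟩ := HN P h hh θ hcpt hRic hθ havr σ hσ hKc hne hreg
  exact ⟨σ, A, hσ, hKσ, hKc, hne, hreg, hA, fun f F c hf hF hpos hfK hcompat ↦
    hsolve f F c hf hF hpos (fun x hx ↦ hfK x fun hxK ↦ absurd (hKσ hxK) (not_lt.2 hx)) hcompat⟩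

end GlueSolvability

end Literature.Geometry.Riemannian
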